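/-
Copyright: cell `pub-ymgap` (HUMAN RULING D-0062), Track A of `YM-PLAN.md`, DAG node N20 (= NE7b); R134 acceleration seat
`pub-ymgap-dag-n20-c` (strategy s1, generation 3), module 14.  Released under the licence of the surrounding project.
-/
import Summits.QuantumFields.YangMills.Theorems.BalabanUVNodesN20LCSConditionalPlaquettes
import HarnessLib

/-!
# YM-DAG node N20 (= NE7b), strategy s1, module 14: CONDITIONAL «LCS-0» FOR DOMINATED CARRIERS — the interface the level-1 instance consumes:
# any non-negative measurable carrier `M` dominated ON THE SMALL-FIELD REGION by `e^{t·Σ_{q∈R}(1 − Re tr U(∂q))}` has conditional expectation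
# `≤ e^{C·(t∕β)·#R}` in the small-field-restricted level-0 state, in the history-term currency of `LocCondStability`

Track A of `YM-PLAN.md` (cell `pub-ymgap`, HUMAN RULING D-0062), node **N20** = spine estimate NE7b (`T4WeightBudget.RelWeightBound` — the
cell `pub-balaban`'s OWN estimate, NOT PRINTED in [Bałaban 1983–89], NOT PROVED).  Seat `pub-ymgap-dag-n20-c` (R134, s1), module 14 (module 13:
`…Theorems.BalabanUVNodesN20LCSConditionalPlaquettes`).  Kernel theorems only: 0 `def`, 0 `sorry`, standard axioms; COUNT-NEUTRAL; `--supports` the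
K3′ item `SpineGivenEndpointR12` (stmt-QuantumFields-19908) as a helper.  Nothing of Bałaban's is asserted.

WHY.  On row NE7b's re-cut road the level-1 carrier is `M = e^{δQ_{1,Z}} ∘ avg` (module 1's push-forward `lcs_coarse_iff_fine`: LCS at the
averaged level ⟺ a fine-level moment of `M ∘ avg` against the level-0 density of the history term), and the seat lineage's residual (i) — the
DOMINATION LETTER for Bałaban's averaging (seat n20-d) — bounds `M ∘ avg` by `e^{t·Σ_{q ∈ R(Z)} A_q}` ON SMALL FIELDS ONLY.  Module 13's
`condLCS_boltzmann` is stated for the carrier `e^{tΣ_Q A}` itself; THIS FILE records the form with a dominated carrier, where the domination is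
required only where the small-field characteristic function does not vanish — exactly the shape in which a small-field estimate is available.

WHAT IS PROVED ([folklore]): `smallField_eq_one_or_zero`, ★ **`condLCS_dominated`** — with `C ≥ 0`, `c > 0` of module 13: for `d = 4`, `β ≥ 4N`,
`βε ≥ c`, `0 ≤ t ≤ β∕32`, a finite plaquette set `R` and a measurable `M ≥ 0` with `M(U) ≤ e^{t·Σ_{q∈R}(1 − Re tr U(∂q))}` whenever ALL plaquettes
of `U` are `ε`-small: `Integrable (M·χ_ε·e^{−βA}) ∏dU` and `∫ M·χ_ε·e^{−βA} ∏dU ≤ e^{C·(t∕β)·#R}·∫ χ_ε·e^{−βA} ∏dU`.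

HONEST FRAMING.  Level 0, all-plaquette restriction, `SU(N)`, `d = 4`; the domination letter itself (residual (i)) is NOT here; levels `≥ 1`
beyond this interface, large-field histories, (A1c) untouched.  NE7b NOT PRINTED ∕ NOT PROVED; (α)-instance 0∕1; N20 NOT discharged; typed 28∕28,
discharged count untouched; NOT ℝ⁴, NOT infinite volume, NOT OS axioms, NOT a mass gap, NOT Clay.
-/

set_option autoImplicit false

noncomputable section

namespace Summit.QuantumFields.YangMills.BalabanUVNodes.N20LCSConditional

open MeasureTheory Finset
open Literature.MathematicalPhysics.QuantumFieldTheory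
open Literature.MathematicalPhysics.QuantumFieldTheory.Balaban1983to89
open Summit.QuantumFields.YangMills.BalabanUVNodes.N20LCSRestrictedChessboard (plaqTerm_mem)

variable {N : ℕ} [NeZero N]

/-! ## §7 Dominated carriers -/

section Dominated

/-- The all-plaquette small-field characteristic function is `1` if every plaquette is `ε`-small and `0` otherwise. [folklore] -/
theorem smallField_eq_one_or_zero (P : Params) (ε : ℝ) (U : GaugeField P 0 (Matrix.specialUnitaryGroup (Fin N) ℂ)) :
    ((∀ p : Plaq P 0, 1 - reTr (GaugeField.plaqHol U p) ≤ ε) ∧ (∏ p : Plaq P 0, (if 1 - reTr (GaugeField.plaqHol U p) ≤ ε then (1 : ℝ) else 0)) = 1) ∨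
      (∏ p : Plaq P 0, (if 1 - reTr (GaugeField.plaqHol U p) ≤ ε then (1 : ℝ) else 0)) = 0 := by
  classical
  by_cases h : ∀ p : Plaq P 0, 1 - reTr (GaugeField.plaqHol U p) ≤ ε
  · exact Or.inl ⟨h, Finset.prod_eq_one fun p _ => if_pos (h p)⟩
  · obtain ⟨p, hp⟩ := not_forall.1 h
    exact Or.inr (Finset.prod_eq_zero (Finset.mem_univ p) (if_neg hp))

/-- **CONDITIONAL «LCS-0» FOR A DOMINATED CARRIER** (history-term currency).  With `C ≥ 0`, `c > 0` of `condLCS_boltzmann`: for a `d = 4`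
parameter set, `β ≥ 4N`, `βε ≥ c`, `0 ≤ t ≤ β∕32`, a finite plaquette set `R` and a measurable carrier `M ≥ 0` which ON THE SMALL-FIELD REGION
(all plaquettes `ε`-small) is at most `e^{t·Σ_{q∈R}(1 − Re tr U(∂q))}`:
`Integrable (M·χ_ε·e^{−βA}) ∏dU` and `∫ M·χ_ε·e^{−βA} ∏dU ≤ e^{C·(t∕β)·#R} · ∫ χ_ε·e^{−βA} ∏dU`, `χ_ε = ∏_p 𝟙[1 − Re tr U(∂p) ≤ ε]`. [folklore] -/
theorem condLCS_dominated (N : ℕ) [NeZero N] :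
    ∃ C c : ℝ, 0 ≤ C ∧ 0 < c ∧ ∀ (P : Params), P.d = 4 → ∀ (β ε t : ℝ), 4 * N ≤ β → c ≤ β * ε → 0 ≤ t → t ≤ β / 32 →
      ∀ (R : Finset (Plaq P 0)) (M : GaugeField P 0 (Matrix.specialUnitaryGroup (Fin N) ℂ) → ℝ), Measurable M → (∀ U, 0 ≤ M U) →
        (∀ U, (∀ p : Plaq P 0, 1 - reTr (GaugeField.plaqHol U p) ≤ ε) →
          M U ≤ Real.exp (t * ∑ q ∈ R, (1 - reTr (GaugeField.plaqHol U q)))) →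
        Integrable (fun U : GaugeField P 0 (Matrix.specialUnitaryGroup (Fin N) ℂ) => (M U * ∏ p : Plaq P 0, (if 1 - reTr (GaugeField.plaqHol U p) ≤ ε then (1 : ℝ) else 0)) * Missing.boltzmann P β U) (fieldMeasure P 0 (Matrix.specialUnitaryGroup (Fin N) ℂ)) ∧
        ∫ U, (M U * ∏ p : Plaq P 0, (if 1 - reTr (GaugeField.plaqHol U p) ≤ ε then (1 : ℝ) else 0)) * Missing.boltzmann P β U ∂(fieldMeasure P 0 (Matrix.specialUnitaryGroup (Fin N) ℂ)) ≤
          Real.exp (C * (t / β) * R.card) * ∫ U, (∏ p : Plaq P 0, (if 1 - reTr (GaugeField.plaqHol U p) ≤ ε then (1 : ℝ) else 0)) * Missing.boltzmann P β U ∂(fieldMeasure P 0 (Matrix.specialUnitaryGroup (Fin N) ℂ)) := by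
  obtain ⟨C, c, hC0, hc, hlcs⟩ := condLCS_boltzmann N
  refine ⟨C, c, hC0, hc, fun P hd β ε t hβ hcε ht0 ht R M hMm hM0 hdom => ?_⟩
  obtain ⟨hint, hle⟩ := hlcs P hd β ε t hβ hcε ht0 ht R
  -- pointwise domination of the restricted carrier
  have hpt : ∀ U : GaugeField P 0 (Matrix.specialUnitaryGroup (Fin N) ℂ),
      (M U * ∏ p : Plaq P 0, (if 1 - reTr (GaugeField.plaqHol U p) ≤ ε then (1 : ℝ) else 0)) * Missing.boltzmann P β U ≤
        (Real.exp (t * ∑ q ∈ R, (1 - reTr (GaugeField.plaqHol U q))) * ∏ p : Plaq P 0, (if 1 - reTr (GaugeField.plaqHol U p) ≤ ε then (1 : ℝ) else 0)) * Missing.boltzmann P β U := by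
    intro U
    refine mul_le_mul_of_nonneg_right ?_ (Missing.boltzmann_pos P β U).le
    rcases smallField_eq_one_or_zero P ε U with ⟨hsmall, h1⟩ | h0
    · rw [h1, mul_one, mul_one]; exact hdom U hsmall
    · rw [h0, mul_zero, mul_zero]
  have hnn : ∀ U : GaugeField P 0 (Matrix.specialUnitaryGroup (Fin N) ℂ), 0 ≤ (M U * ∏ p : Plaq P 0, (if 1 - reTr (GaugeField.plaqHol U p) ≤ ε then (1 : ℝ) else 0)) * Missing.boltzmann P β U := fun U =>
    mul_nonneg (mul_nonneg (hM0 U) (Finset.prod_nonneg fun p _ => by split_ifs <;> norm_num)) (Missing.boltzmann_pos P β U).le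
  -- measurability of the restricted carrier times the Boltzmann weight
  have hWm : Measurable fun U : GaugeField P 0 (Matrix.specialUnitaryGroup (Fin N) ℂ) => ∏ p : Plaq P 0, (if 1 - reTr (GaugeField.plaqHol U p) ≤ ε then (1 : ℝ) else 0) :=
    Finset.measurable_prod _ fun p _ => Measurable.ite (measurableSet_le (measurable_const.sub
      (RegularGaugeGroup.measurable_reTr.comp (Missing.measurable_plaqHol (G := Matrix.specialUnitaryGroup (Fin N) ℂ) p)))
        measurable_const) measurable_const measurable_const
  have hmeas : AEStronglyMeasurable (fun U : GaugeField P 0 (Matrix.specialUnitaryGroup (Fin N) ℂ) => (M U * ∏ p : Plaq P 0, (if 1 - reTr (GaugeField.plaqHol U p) ≤ ε then (1 : ℝ) else 0)) * Missing.boltzmann P β U)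
      (fieldMeasure P 0 (Matrix.specialUnitaryGroup (Fin N) ℂ)) :=
    ((hMm.mul hWm).mul (Missing.measurable_boltzmann RegularGaugeGroup.measurable_reTr P β)).aestronglyMeasurable
  have hint' : Integrable (fun U : GaugeField P 0 (Matrix.specialUnitaryGroup (Fin N) ℂ) => (M U * ∏ p : Plaq P 0, (if 1 - reTr (GaugeField.plaqHol U p) ≤ ε then (1 : ℝ) else 0)) * Missing.boltzmann P β U) (fieldMeasure P 0 (Matrix.specialUnitaryGroup (Fin N) ℂ)) :=
    Integrable.mono' hint hmeas (ae_of_all _ fun U => by rw [Real.norm_eq_abs, abs_of_nonneg (hnn U)]; exact hpt U)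
  exact ⟨hint', (integral_mono hint' hint hpt).trans hle⟩

end Dominated

end Summit.QuantumFields.YangMills.BalabanUVNodes.N20LCSConditional

end
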